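import Summits.CriticalPhenomena.SAWScalingLimit.Theses.SAWChargeContinuation
import Literature.Probability.RandomPlanarGeometry.HullSubdomainPullback
import Literature.Probability.RandomPlanarGeometry.RestrictionHullsProofs
import Literature.Probability.RandomPlanarGeometry.JordanDomainProofs

/-!
# Birth skeleton (`Lines/birth.lean`) for crux `WindowAvoidanceLaw` (stmt-CriticalPhenomena-11192)

Route `SAWChargeContinuation` of `CriticalPhenomena/SAWScalingLimit`, crux r2 (P)
`WindowAvoidanceLaw`: there are `ε > 0` and fugacities `y(s) > 0` with `y(1) = 1/4` such that for
every charge `s ∈ [1-ε, 1]` and all restriction data `(D, D′, a_δ, b_δ, φ, Φ, d = Φ_A′(0))` the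
avoidance ratio of the `λ`-SAW family (Kozdron–Lawler; weights `y^|γ| e^{s·m(γ)}`, `m` = rooted
random-walk loop measure of the loops meeting `γ`)

  `R_δ(s, y) := Z(D_δ|D′; s, y) / Z(D_δ; s, y) ⟶ d^{α(s)}`   (`δ → 0⁺`),

`α(s) = (5 + 2s + √((13+2s)² − 144))/16` (`α(1) = 1`, `α(0) = 5/8`).  The vocabulary `hull`, `pb`,
`G`, `m`, `Z`, `α` below is copied VERBATIM from the route decl (there inlined by `let`), so that
the composition `WindowAvoidanceLaw_of` concludes the crux BY NAME.

## The line: free-fermion anchor ⊗ charge deformation of loop-erased-walk exponential moments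

By Lawler's identity `Σ_{LE(ω)=η} 4^{-|ω|} = 4^{-|η|} e^{m_U(η)}` (tree:
`tsum_loopErase_eq_exp_rwLoopMass_holds`) the partition function factorises, for EVERY `(s, y)` and
every sub-graph `U`, as

  `Z(U; s, y) = Σ_η (4y)^{|η|} e^{-(1-s) m_U(η)} · 4^{-|η|} e^{m_U(η)} = G_U(a, b) · E^{LERW(U; a→b)}[F_{s,y}]`,
  `F_{s,y}(η) = (4y)^{|η|} e^{-(1-s)·m_U(η)}`,

with `G_U` the Green's function of the simple random walk killed off `U` and `LERW(U; a → b)` the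
loop-erasure of the random-walk excursion from `a` to `b` in `U`.  Hence the crux splits EXACTLY
into a potential-theoretic factor and a loop-erased-walk factor:

  `R_δ(s, y) = [G_{U′}(a,b)/G_U(a,b)] · (E^{LERW(U′)}[F_{s,y}] / E^{LERW(U)}[F_{s,y}])`
            `=        R_δ(1, 1/4)      ·       (R_δ(s, y) / R_δ(1, 1/4))`.

* `stub_anchorExcursion : AnchorExcursion` (L; the route's own support item stmt-11196, much of it
  already reduced in `Theorems/SAWChargeContinuationAnchorExcursion*.lean`) — the free-fermion
  point `s = 1`, `y = 1/4`: `R_δ(1, 1/4) = G_{U′}/G_U → d = Φ_A′(0)`, the probability that the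
  Brownian excursion `a → b` in `D` avoids `D ∖ D′` ([LSW03] Prop. 4.1, tree:
  `exists_isRestrictionMeasure_one_brownianQuad`).  Discrete potential theory only.
* `stub_chargeDeformation : ChargeDeformationLaw` (open-problem; HARDEST, load-bearing) — the
  CHARGE DEFORMATION of the loop-erased walk: in a window `s ∈ [1-ε, 1]`, along a fugacity curve
  `y(s)` with `y(1) = 1/4`, the ratio of LERW exponential moments of the charge functional in the
  sub-domain and in the domain converges,
  `R_δ(s, y(s)) / R_δ(1, 1/4) = E^{LERW(U′)}[F_s] / E^{LERW(U)}[F_s] ⟶ d^{α(s) - 1}`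
  (a statement about ONE determinantal / free-fermion object, the LERW, and the random-walk loop
  soup it is coupled to; at first order in `1 - s` the exponent moves with slope `α′(1) = 1/3`).
  This is where the item's "why it might fail" lives (marginal tilt, `κ` must move from `2`).
* PROVED glue (no `sorry`) inside `WindowAvoidanceLaw_of`: under the crux's hypotheses `d` IS the
  honest derivative `Φ_A′(0) > 0` of the `*`-hull `A = closure(ℍ ∖ φ⁻¹ D′)`
  (`IsStarHull.pullbackHull`, `IsStarHull.exists_hasRestrictionDeriv_holds`,
  `HasRestrictionDeriv.unique`), so the anchor ratio is eventually non-zero, the double ratio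
  times the anchor IS `R_δ(s, y(s))` eventually, and `d^{α(s)-1} · d = d^{α(s)}`; the product of
  the two limits is the crux, concluded BY NAME.

## Disproof / negatives used
* `Cruxes/WindowAvoidanceLaw/Disproof.lean`: none exists (`ledger crux ls stmt-CriticalPhenomena-11192`:
  no workfiles at registration, 2026-08-17) — no `_false_without_` obstruction to honour.
* Refuter evidence on the item (crux-attack 2026-08-15, SURVIVES): `WindowAvoidanceLaw → AnchorExcursion`
  (the `s = 1` member IS the anchor: `y 1 = 1/4`, `α 1 = 1` via `√81 = 9`) — consistent with this
  split (the anchor is necessary); the typed `s = 1` lattice identity was checked exactly on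
  `3×3 / 4×3 / 4×4` boxes (`finite_check_s1.py`, `R(1) = 241/259, …`).
* `ledger negatives --problem CriticalPhenomena`: the only SAW-side negative of this route's cone
  (stmt-0772, tightness over ALL `δ`) is not approached — no tightness is asserted here; both stubs
  are `δ → 0⁺` limit statements along endpoint approximations, exactly as the crux.
* Vacuity pass: `ChargeDeformationLaw` has no trivial witness — at `s = 1` it forces
  `R_δ(1, y 1)/R_δ(1, 1/4) = 1 → d^0 = 1` (consistent, `y 1 = 1/4`), and for `s < 1`, `d < 1` the
  target `d^{α(s)-1} > 1` is neither `0` (junk of an empty SAW sum) nor `1` (the `D′ = D`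
  degeneration); `ε`, `y` are existential exactly as in the crux, so no coordination is smuggled.
-/

noncomputable section

open scoped BigOperators Topology Manifold Classical MeasureTheory ProbabilityTheory Matrix InnerProductSpace ComplexConjugate ContinuousMap
open Filter Set Function TopologicalSpace MeasureTheory
open Literature.Probability.RandomPlanarGeometry Literature.Probability.LatticeModels
open Summit.CriticalPhenomena.SAWScalingLimit.Theses.SAWChargeContinuation

namespace Summit.CriticalPhenomena.SAWScalingLimit.Cruxes.WindowAvoidanceLaw.Birth

/-! ### 1. Vocabulary (verbatim from the crux `SAWChargeContinuation.WindowAvoidanceLaw`) -/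

/-- Hull subdomain `D′` of `D` (the crux's inlined `hull`; definitionally
`MarkedDomain.IsHullSubdomain`). -/
abbrev hull (D D' : Literature.Probability.RandomPlanarGeometry.DobrushinDomain) : Prop :=
  D'.carrier ⊆ D.carrier ∧ D'.pt 0 = D.pt 0 ∧ D'.pt 1 = D.pt 1 ∧ D.pt 0 ∉ closure (D.carrier \ D'.carrier) ∧ D.pt 1 ∉ closure (D.carrier \ D'.carrier)

/-- The pulled-back hull `A = closure (ℍ ∖ φ⁻¹ D′)` (the crux's inlined `pb`; definitionally
`ConformalEquiv.pullbackHull φ D′`). -/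
abbrev pb (D : Literature.Probability.RandomPlanarGeometry.DobrushinDomain)
    (φ : Literature.Probability.RandomPlanarGeometry.ConformalEquiv UpperHalfPlane.upperHalfPlaneSet D.carrier)
    (D' : Literature.Probability.RandomPlanarGeometry.DobrushinDomain) : Set ℂ :=
  closure (UpperHalfPlane.upperHalfPlaneSet \ {z | z ∈ UpperHalfPlane.upperHalfPlaneSet ∧ φ z ∈ D'.carrier})

/-- The sub-graph `G(Ω, Ω′, δ)` of `Ω_δ`: edges of `Ω_δ` that are closed mesh edges of `Ω′` between
mesh vertices of `Ω′` (the crux's inlined `G`; `G(Ω, Ω, δ) ⊇ Ω_δ`). -/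
abbrev G (Ω Ω' : Set ℂ) (δ : ℝ) : SimpleGraph (Literature.Probability.LatticeModels.Site 2) :=
  SimpleGraph.fromRel fun x y => (Literature.Probability.LatticeModels.discreteDomainGraph Ω δ).Adj x y ∧ (Literature.Probability.LatticeModels.meshGraph Ω' δ).Adj x y ∧ x ∈ Literature.Probability.LatticeModels.meshVertices Ω' δ ∧ y ∈ Literature.Probability.LatticeModels.meshVertices Ω' δ

/-- The rooted random-walk loop measure `m(γ)` (weight `4^{-n}/n`) of the closed walks of
`G(Ω, Ω′, δ)` meeting `γ` (the crux's inlined `m`; Kennedy–Lawler §1.1). -/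
abbrev m (Ω Ω' : Set ℂ) (δ : ℝ) (a b : Literature.Probability.LatticeModels.Site 2)
    (γ : Literature.Probability.RandomPlanarGeometry.SAW.DomainSAW Ω δ a b) : ℝ :=
  ∑' p : (Σ x : Literature.Probability.LatticeModels.Site 2, (G Ω Ω' δ).Walk x x), if 0 < p.2.length ∧ (∃ v ∈ p.2.support, v ∈ γ.walk.support) then (1 / 4 : ℝ) ^ p.2.length / (p.2.length : ℝ) else 0

/-- The `λ`-SAW partition function `Z(Ω_δ|Ω′; s, y) = Σ_γ y^{|γ|} e^{s·m(γ)}` over the SAWs of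
`Ω_δ` from `a` to `b` using only edges of `G(Ω, Ω′, δ)` (the crux's inlined `Z`). -/
abbrev Z (Ω Ω' : Set ℂ) (δ : ℝ) (a b : Literature.Probability.LatticeModels.Site 2) (s y : ℂ) : ℂ :=
  ∑' γ : Literature.Probability.RandomPlanarGeometry.SAW.DomainSAW Ω δ a b, if (∀ e ∈ γ.walk.darts, (G Ω Ω' δ).Adj e.fst e.snd) then y ^ γ.length * Complex.exp (s * (m Ω Ω' δ a b γ : ℂ)) else 0

/-- The restriction exponent `α(s) = (6 - κ)/(2κ)` at central charge `c(κ) = -2s` (the crux's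
inlined `α`; `α(1) = 1`, `α(0) = 5/8`). -/
abbrev α (s : ℝ) : ℝ :=
  (5 + 2 * s + Real.sqrt ((13 + 2 * s) ^ 2 - 144)) / 16

/-- The avoidance ratio `R_δ(s, y) = Z(D_δ|D′; s, y) / Z(D_δ; s, y)` along an endpoint
approximation `(a_δ, b_δ)` (the function whose limit the crux asserts). -/
abbrev R (D D' : Literature.Probability.RandomPlanarGeometry.DobrushinDomain)
    (a b : ℝ → Literature.Probability.LatticeModels.Site 2) (δ : ℝ) (s y : ℂ) : ℂ :=
  Z D.carrier D'.carrier δ (a δ) (b δ) s y / Z D.carrier D.carrier δ (a δ) (b δ) s y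

/-- STUB 2 statement — **charge deformation law of the loop-erased walk**: there are `ε > 0` and a
fugacity curve `y(s) > 0` with `y(1) = 1/4` such that for every `s ∈ [1-ε, 1]` and all restriction
data, the DOUBLE ratio `R_δ(s, y(s)) / R_δ(1, 1/4)` — by Lawler's identity the ratio
`E^{LERW(U′)}[F_s] / E^{LERW(U)}[F_s]` of loop-erased-walk exponential moments of the charge
functional `F_s(η) = (4y(s))^{|η|} e^{-(1-s) m(η)}` in the sub-domain graph `U′ = G(D, D′, δ)` and in
`U = D_δ` — converges to `d^{α(s) - 1}` as `δ → 0⁺`. -/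
def ChargeDeformationLaw : Prop :=
  ∃ ε > (0 : ℝ), ∃ y : ℝ → ℝ, y 1 = 1 / 4 ∧ ∀ s ∈ Set.Icc (1 - ε) 1, 0 < y s ∧
    ∀ (D D' : Literature.Probability.RandomPlanarGeometry.DobrushinDomain), hull D D' →
    ∀ (a b : ℝ → Literature.Probability.LatticeModels.Site 2),
      Literature.Probability.RandomPlanarGeometry.SAW.IsEndpointApprox D a b →
    ∀ (φ : Literature.Probability.RandomPlanarGeometry.ConformalEquiv UpperHalfPlane.upperHalfPlaneSet D.carrier),
      D.IsChordalUniformizing φ →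
    ∀ (Φ : Literature.Probability.RandomPlanarGeometry.ConformalEquiv (UpperHalfPlane.upperHalfPlaneSet \ pb D φ D') UpperHalfPlane.upperHalfPlaneSet) (d : ℝ),
      Literature.Probability.RandomPlanarGeometry.IsRestrictionMap (pb D φ D') Φ →
      Literature.Probability.RandomPlanarGeometry.HasRestrictionDeriv (pb D φ D') Φ d →
      Filter.Tendsto (fun δ => R D D' a b δ s (y s) / R D D' a b δ 1 (1 / 4))
        (nhdsWithin 0 (Set.Ioi 0)) (nhds ((d ^ (α s - 1) : ℝ) : ℂ))

/-! ### 2. The registered stubs (the only `sorry`s of the file) -/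

/-- STUB 1 (L): the free-fermion anchor `s = 1`, `y = 1/4` — the route's support item
`AnchorExcursion` (stmt-CriticalPhenomena-11196) BY NAME: `R_δ(1, 1/4) → d = Φ_A′(0)`. -/
theorem stub_anchorExcursion : AnchorExcursion := by
  sorry

/-- STUB 2 (open-problem, HARDEST): the charge deformation law of loop-erased-walk exponential
moments in a window at the free-fermion point. -/
theorem stub_chargeDeformation : ChargeDeformationLaw := by
  sorry

/-! ### Name-keyed aliases of the stub statements (hypotheses of the composition)

`Registered.stub_X : Prop` is the statement of `stub_X` under the registered stub's short name, so
that the skeleton audit (`#h21_check_skeleton`: hypotheses admissible iff registered stubs BY NAME)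
accepts `WindowAvoidanceLaw_of : Registered.stub_… → … → WindowAvoidanceLaw` (device of
`Cruxes/ChainLaw/Lines/birth.lean`). -/
namespace Registered

/-- Alias keyed by the registered stub name. -/
abbrev stub_anchorExcursion : Prop := AnchorExcursion
/-- Alias keyed by the registered stub name. -/
abbrev stub_chargeDeformation : Prop := ChargeDeformationLaw

end Registered

/-! ### 3. The sorry-free part: positivity of `d`, and the composition -/

/-- **No junk `d` (PROVED glue).** Under the crux's hypotheses the number `d` IS the restriction
derivative `Φ_A′(0) > 0`: the pulled-back hull of a hull subdomain under a chordal uniformizer is a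
`*`-hull (`IsStarHull.pullbackHull`, Jordan domains being simply connected), whose restriction
derivative exists in `(0, 1]` (`IsStarHull.exists_hasRestrictionDeriv_holds`, [LSW03] (2.4)) and
is unique (`HasRestrictionDeriv.unique`). -/
theorem restrictionDeriv_pos {D D' : DobrushinDomain} (hDD' : hull D D')
    {φ : ConformalEquiv UpperHalfPlane.upperHalfPlaneSet D.carrier} (hφ : D.IsChordalUniformizing φ)
    {Φ : ConformalEquiv (UpperHalfPlane.upperHalfPlaneSet \ pb D φ D') UpperHalfPlane.upperHalfPlaneSet}
    {d : ℝ} (hΦ : IsRestrictionMap (pb D φ D') Φ) (hd : HasRestrictionDeriv (pb D φ D') Φ d) :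
    0 < d := by
  have hstar : IsStarHull (φ.pullbackHull D') :=
    IsStarHull.pullbackHull JordanDomain.isSimplyConnected_holds hφ hDD'
  obtain ⟨d₀, hd₀, -, hd₀'⟩ := IsStarHull.exists_hasRestrictionDeriv_holds hstar hΦ
  have hdd : d = d₀ := hd.unique hstar hd₀'
  exact hdd ▸ hd₀

/-- **The composition (kernel-checked, no `sorry`)**: the two stubs imply the crux
`WindowAvoidanceLaw` BY NAME.  Take the window `ε` and the fugacity curve `y` of STUB 2; for
`s ∈ [1-ε, 1]` and restriction data `(D, D′, a, b, φ, Φ, d)`: `d > 0` (`restrictionDeriv_pos`), so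
the anchor ratio `R_δ(1, 1/4) → d` (STUB 1) is eventually non-zero and
`R_δ(s, y s) = (R_δ(s, y s)/R_δ(1, 1/4)) · R_δ(1, 1/4)` eventually; the product of the two limits is
`d^{α(s)-1} · d = d^{α(s)}`. -/
theorem WindowAvoidanceLaw_of (h₁ : Registered.stub_anchorExcursion)
    (h₂ : Registered.stub_chargeDeformation) :
    Summit.CriticalPhenomena.SAWScalingLimit.Theses.SAWChargeContinuation.WindowAvoidanceLaw := by
  have hA : AnchorExcursion := h₁
  dsimp only [AnchorExcursion] at hA
  obtain ⟨ε, hε, y, hy1, hwin⟩ := (h₂ : ChargeDeformationLaw)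
  dsimp only [WindowAvoidanceLaw]
  refine ⟨ε, hε, y, hy1, fun s hs => ⟨(hwin s hs).1, ?_⟩⟩
  intro D D' hDD' a b hab φ hφ Φ d hΦ hd
  -- `d` is the honest restriction derivative, hence positive
  have hdpos : 0 < d := restrictionDeriv_pos hDD' hφ hΦ hd
  -- the anchor limit (STUB 1) and the deformation limit (STUB 2) along these data
  have hlim1 : Tendsto (fun δ => R D D' a b δ 1 (1 / 4)) (𝓝[>] 0) (𝓝 (d : ℂ)) :=
    hA D D' hDD' a b hab φ hφ Φ d hΦ hd
  have hlim2 : Tendsto (fun δ => R D D' a b δ s (y s) / R D D' a b δ 1 (1 / 4)) (𝓝[>] 0)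
      (𝓝 ((d ^ (α s - 1) : ℝ) : ℂ)) :=
    (hwin s hs).2 D D' hDD' a b hab φ hφ Φ d hΦ hd
  -- the anchor ratio is eventually non-zero
  have hne : ∀ᶠ δ in 𝓝[>] (0 : ℝ), R D D' a b δ 1 (1 / 4) ≠ 0 :=
    hlim1.eventually_ne (by exact_mod_cast hdpos.ne')
  -- product of the limits
  have hval : ((d ^ (α s - 1) : ℝ) : ℂ) * (d : ℂ) = ((d ^ (α s) : ℝ) : ℂ) := by
    rw [← Complex.ofReal_mul, Real.rpow_sub_one hdpos.ne', div_mul_cancel₀ _ hdpos.ne']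
  have key : Tendsto (fun δ => R D D' a b δ s (y s)) (𝓝[>] 0) (𝓝 ((d ^ (α s) : ℝ) : ℂ)) := by
    rw [← hval]
    refine (hlim2.mul hlim1).congr' ?_
    filter_upwards [hne] with δ hδ
    exact div_mul_cancel₀ _ hδ
  exact key

/-- Wiring check: the registered stubs feed `WindowAvoidanceLaw_of` as stated. -/
example : Summit.CriticalPhenomena.SAWScalingLimit.Theses.SAWChargeContinuation.WindowAvoidanceLaw :=
  WindowAvoidanceLaw_of stub_anchorExcursion stub_chargeDeformation

end Summit.CriticalPhenomena.SAWScalingLimit.Cruxes.WindowAvoidanceLaw.Birth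

end
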